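import Summits.QuantumFields.QCD.Theses.RenormalisedVafaWitten
import Summits.QuantumFields.QCD.Theorems.HeatSlicedQuarksAccretiveWilsonDirac
import HarnessLib

/-!
# `WilsonDiracAccretive` (stmt-QuantumFields-8697, route RenormalisedVafaWitten, support) — proved

**Accretivity of the Wilson–Dirac operator** for every Wilson parameter `r ≥ 0`: for a unitary
representation `ρ`, every gauge field `U` on the four-torus, every bare mass `m` and every colour–spin field `v`,

`m · Σ_i ‖v_i‖² ≤ Re⟨v, D_W(U, m, r) v⟩`.

Proof (the general-`r` twin of the tree's `r = 1` analysis in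
`Theorems/HeatSlicedQuarksAccretiveWilsonDirac.lean` / `Literature…OverlapLocality`, whose quadratic-form generalities
`re_quadForm_conjTranspose`, `sum_norm_sq_mulVec_sub_self`, `conjTranspose_mul_linkHopSpin` are reused): the tree's `wilsonDirac` is
`(m + 4r)·1 − Σ_μ W_μ(r)` with `W_μ(r) = F_μ ⊗ ½(r − γ_μ) + F_μᴴ ⊗ ½(r + γ_μ)` on (site ⊗ colour) ⊗ spin, `F_μ` the
`U`-twisted forward shift (`linkHop`) (`wilsonDirac_eq_sub_sum_hop`).  Since `½(r + γ_μ)` is Hermitian and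
`½(r − γ_μ) + ½(r + γ_μ) = r`, the real quadratic form of `W_μ(r)` is `r · Re⟨v, T_μ v⟩` for the spin-trivial transport
`T_μ = F_μ ⊗ 1` (`re_quadForm_hop_eq`); `T_μ` is an isometry, so `Re⟨v, T_μ v⟩ ≤ ‖v‖²`
(`sum_norm_sq_mulVec_sub_self`), whence `Re⟨v, D_W v⟩ ≥ (m + 4r)‖v‖² − 4r‖v‖² = m‖v‖²` for `r ≥ 0`.
Width seat ym-line-sfw-p2-w2 g24 (cell ym-idea-1; free hands).  HONEST FRAMING: an elementary support lemma (card F1) of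
the route; no crux, rung or summit is proved; nothing here bears on the Yang–Mills mass gap.
[cite: MontvayMunster1994, §4.2.2 (4.85) with §5.1.1 (5.5)] [cite: Wilson1975]
-/

set_option autoImplicit false

namespace Summit.QuantumFields.QCD.Theorems.RenormalisedVafaWittenWilsonDiracAccretive

open Literature.MathematicalPhysics.QuantumLattice Literature.MathematicalPhysics.QuantumFieldTheory
open Literature.Probability.LatticeModels Matrix
open Summit.QuantumFields.QCD.Theorems.HeatSlicedQuarksAccretiveWilsonDirac
open scoped Kronecker

section Wilson

variable {L N : ℕ} {G : Type} [Group G] (ρ : G →* Matrix (Fin N) (Fin N) ℂ) [NeZero L]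

omit [NeZero L] in
/-- **`D_W(U, m, r) = (m + 4r)·1 − Σ_μ W_μ(r)`** with `W_μ(r) = F_μ ⊗ ½(r − γ_μ) + F_μᴴ ⊗ ½(r + γ_μ)` — the general-`r`
form of the tree's `wilsonDirac_eq_sub_sum_wilsonHop` (`r = 1`). [cite: MontvayMunster1994, §4.2.2 (4.85)] -/
theorem wilsonDirac_eq_sub_sum_hop (hρ : ∀ g, ρ g ∈ Matrix.unitaryGroup (Fin N) ℂ)
    (U : GaugeConfig 4 L G) (m r : ℝ) :
    wilsonDirac ρ U m r =
      ((m + 4 * r : ℝ) : ℂ) • (1 : Matrix _ _ ℂ) - ∑ μ, Matrix.reindex (Equiv.prodAssoc _ _ _) (Equiv.prodAssoc _ _ _)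
        (linkHop ρ U μ ⊗ₖ ((2 : ℂ)⁻¹ • ((r : ℂ) • (1 : Matrix (Fin 4) (Fin 4) ℂ) - euclideanGamma μ)) +
          (linkHop ρ U μ)ᴴ ⊗ₖ ((2 : ℂ)⁻¹ • ((r : ℂ) • (1 : Matrix (Fin 4) (Fin 4) ℂ) + euclideanGamma μ))) := by
  ext p q
  simp only [wilsonDirac, linkHop, ← star_rep_eq_rep_inv ρ hρ, Matrix.star_apply,
    Matrix.of_apply, Matrix.sub_apply, Matrix.smul_apply, Matrix.sum_apply, Matrix.reindex_apply,
    Matrix.submatrix_apply, Equiv.prodAssoc_symm_apply, Matrix.add_apply,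
    Matrix.kroneckerMap_apply, conjTranspose_apply, Matrix.one_apply, smul_eq_mul]
  simp only [star_ite_zero, Finset.mul_sum]
  congr 1
  · split_ifs <;> push_cast <;> ring
  · refine Finset.sum_congr rfl fun μ _ => ?_
    split_ifs <;> ring

/-- `½(r + γ_μ)` is Hermitian for real `r`. [folklore] -/
theorem conjTranspose_half_add_gamma (r : ℝ) (μ : Fin 4) :
    ((2 : ℂ)⁻¹ • ((r : ℂ) • (1 : Matrix (Fin 4) (Fin 4) ℂ) + euclideanGamma μ))ᴴ =
      (2 : ℂ)⁻¹ • ((r : ℂ) • (1 : Matrix (Fin 4) (Fin 4) ℂ) + euclideanGamma μ) := by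
  rw [conjTranspose_smul, conjTranspose_add, conjTranspose_smul, conjTranspose_one,
    (euclideanGamma_isHermitian μ).eq]
  simp

/-- **`Re⟨v, W_μ(r) v⟩ = r · Re⟨v, T_μ v⟩`**: in the real quadratic form the hopping matrix `W_μ(r)` may be replaced by
`r` times the spin-trivial transport `T_μ = F_μ ⊗ 1` (the `γ_μ`-parts are anti-Hermitian and drop out). [folklore] -/
theorem re_quadForm_hop_eq (U : GaugeConfig 4 L G) (μ : Fin 4) (r : ℝ) (v : TorusSite 4 L × Fin N × Fin 4 → ℂ) :
    (star v ⬝ᵥ Matrix.reindex (Equiv.prodAssoc _ _ _) (Equiv.prodAssoc _ _ _)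
        (linkHop ρ U μ ⊗ₖ ((2 : ℂ)⁻¹ • ((r : ℂ) • (1 : Matrix (Fin 4) (Fin 4) ℂ) - euclideanGamma μ)) +
          (linkHop ρ U μ)ᴴ ⊗ₖ ((2 : ℂ)⁻¹ • ((r : ℂ) • (1 : Matrix (Fin 4) (Fin 4) ℂ) + euclideanGamma μ))) *ᵥ v).re =
      r * (star v ⬝ᵥ Matrix.reindex (Equiv.prodAssoc _ _ _) (Equiv.prodAssoc _ _ _)
        (linkHop ρ U μ ⊗ₖ (1 : Matrix (Fin 4) (Fin 4) ℂ)) *ᵥ v).re := by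
  have hT : ((linkHop ρ U μ ⊗ₖ ((2 : ℂ)⁻¹ • ((r : ℂ) • (1 : Matrix (Fin 4) (Fin 4) ℂ) + euclideanGamma μ))).submatrix
      (Equiv.prodAssoc (TorusSite 4 L) (Fin N) (Fin 4)).symm
      (Equiv.prodAssoc (TorusSite 4 L) (Fin N) (Fin 4)).symm)ᴴ =
      ((linkHop ρ U μ)ᴴ ⊗ₖ ((2 : ℂ)⁻¹ • ((r : ℂ) • (1 : Matrix (Fin 4) (Fin 4) ℂ) + euclideanGamma μ))).submatrix
        (Equiv.prodAssoc (TorusSite 4 L) (Fin N) (Fin 4)).symm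
        (Equiv.prodAssoc (TorusSite 4 L) (Fin N) (Fin 4)).symm := by
    rw [conjTranspose_submatrix, conjTranspose_kronecker, conjTranspose_half_add_gamma]
  have hadd : ∀ A B : Matrix ((TorusSite 4 L × Fin N) × Fin 4) ((TorusSite 4 L × Fin N) × Fin 4) ℂ,
      (A + B).submatrix (Equiv.prodAssoc (TorusSite 4 L) (Fin N) (Fin 4)).symm
          (Equiv.prodAssoc (TorusSite 4 L) (Fin N) (Fin 4)).symm =
        A.submatrix (Equiv.prodAssoc (TorusSite 4 L) (Fin N) (Fin 4)).symm
            (Equiv.prodAssoc (TorusSite 4 L) (Fin N) (Fin 4)).symm +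
          B.submatrix (Equiv.prodAssoc (TorusSite 4 L) (Fin N) (Fin 4)).symm
            (Equiv.prodAssoc (TorusSite 4 L) (Fin N) (Fin 4)).symm := fun _ _ => rfl
  have hsmul : ∀ (c : ℂ) (A : Matrix ((TorusSite 4 L × Fin N) × Fin 4) ((TorusSite 4 L × Fin N) × Fin 4) ℂ),
      (c • A).submatrix (Equiv.prodAssoc (TorusSite 4 L) (Fin N) (Fin 4)).symm
          (Equiv.prodAssoc (TorusSite 4 L) (Fin N) (Fin 4)).symm =
        c • A.submatrix (Equiv.prodAssoc (TorusSite 4 L) (Fin N) (Fin 4)).symm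
            (Equiv.prodAssoc (TorusSite 4 L) (Fin N) (Fin 4)).symm := fun _ _ => rfl
  have hsum : (2 : ℂ)⁻¹ • ((r : ℂ) • (1 : Matrix (Fin 4) (Fin 4) ℂ) - euclideanGamma μ) +
      (2 : ℂ)⁻¹ • ((r : ℂ) • (1 : Matrix (Fin 4) (Fin 4) ℂ) + euclideanGamma μ) =
        (r : ℂ) • (1 : Matrix (Fin 4) (Fin 4) ℂ) := by
    rw [← smul_add, sub_add_add_cancel, ← two_smul ℂ, smul_smul, inv_mul_cancel₀ two_ne_zero, one_smul]
  rw [reindex_apply, reindex_apply, hadd, add_mulVec, dotProduct_add, Complex.add_re, ← hT,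
    re_quadForm_conjTranspose, ← Complex.add_re, ← dotProduct_add, ← add_mulVec, ← hadd, ← kronecker_add, hsum,
    kronecker_smul, hsmul, smul_mulVec, dotProduct_smul, smul_eq_mul, Complex.re_ofReal_mul]

/-- **`WilsonDiracAccretive`** (stmt-QuantumFields-8697): `m Σ_i ‖v_i‖² ≤ Re⟨v, D_W(U, m, r) v⟩` for unitary `ρ` and
`r ≥ 0` — the Hermitian part of `D_W` is `(m + 4r) − r Σ_μ ½(T_μ + T_μᴴ) ≥ m` (each `T_μ` an isometry), the `γ_μ` part
being anti-Hermitian. [cite: MontvayMunster1994, §4.2.2 (4.85) with §5.1.1 (5.5)] -/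
theorem wilsonDiracAccretive_proof : Summit.QuantumFields.QCD.Theses.RenormalisedVafaWitten.WilsonDiracAccretive := by
  intro L N _ G _ ρ hρ U m r hr v
  have hLHS : (∑ i, star (v i) * (wilsonDirac ρ U m r *ᵥ v) i) = star v ⬝ᵥ wilsonDirac ρ U m r *ᵥ v := rfl
  have hre : (star v ⬝ᵥ v).re = ∑ i, ‖v i‖ ^ 2 := by
    rw [dotProduct, Complex.re_sum]
    refine Finset.sum_congr rfl fun i _ => ?_
    rw [Pi.star_apply, Complex.star_def, ← Complex.normSq_eq_conj_mul_self, Complex.ofReal_re,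
      Complex.normSq_eq_norm_sq]
  -- `Re⟨v, D v⟩ = (m + 4r)‖v‖² − r Σ_μ Re⟨v, T_μ v⟩`
  have hform : (star v ⬝ᵥ wilsonDirac ρ U m r *ᵥ v).re =
      (m + 4 * r) * ∑ i, ‖v i‖ ^ 2 - ∑ μ : Fin 4, r * (star v ⬝ᵥ Matrix.reindex (Equiv.prodAssoc _ _ _)
        (Equiv.prodAssoc _ _ _) (linkHop ρ U μ ⊗ₖ (1 : Matrix (Fin 4) (Fin 4) ℂ)) *ᵥ v).re := by
    rw [wilsonDirac_eq_sub_sum_hop ρ hρ U m r, sub_mulVec, smul_mulVec, one_mulVec, sum_mulVec,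
      dotProduct_sub, dotProduct_smul, dotProduct_sum, Complex.sub_re, smul_eq_mul, Complex.re_ofReal_mul,
      Complex.re_sum, hre]
    congr 1
    exact Finset.sum_congr rfl fun μ _ => re_quadForm_hop_eq ρ U μ r v
  -- each transport is an isometry, so its real quadratic form is at most `‖v‖²`
  have hT : ∀ μ : Fin 4, (star v ⬝ᵥ Matrix.reindex (Equiv.prodAssoc _ _ _) (Equiv.prodAssoc _ _ _)
      (linkHop ρ U μ ⊗ₖ (1 : Matrix (Fin 4) (Fin 4) ℂ)) *ᵥ v).re ≤ ∑ i, ‖v i‖ ^ 2 := by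
    intro μ
    have h := sum_norm_sq_mulVec_sub_self _ (conjTranspose_mul_linkHopSpin ρ hρ U μ) v
    have h0 : 0 ≤ ∑ i, ‖(Matrix.reindex (Equiv.prodAssoc _ _ _) (Equiv.prodAssoc _ _ _)
        (linkHop ρ U μ ⊗ₖ (1 : Matrix (Fin 4) (Fin 4) ℂ)) *ᵥ v - v) i‖ ^ 2 :=
      Finset.sum_nonneg fun i _ => by positivity
    linarith
  rw [hLHS, hform]
  have hsum : ∑ μ : Fin 4, r * (star v ⬝ᵥ Matrix.reindex (Equiv.prodAssoc _ _ _) (Equiv.prodAssoc _ _ _)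
      (linkHop ρ U μ ⊗ₖ (1 : Matrix (Fin 4) (Fin 4) ℂ)) *ᵥ v).re ≤ ∑ _μ : Fin 4, r * ∑ i, ‖v i‖ ^ 2 :=
    Finset.sum_le_sum fun μ _ => mul_le_mul_of_nonneg_left (hT μ) hr
  rw [Finset.sum_const, Finset.card_univ, Fintype.card_fin] at hsum
  simp only [nsmul_eq_mul, Nat.cast_ofNat] at hsum
  linarith

end Wilson

end Summit.QuantumFields.QCD.Theorems.RenormalisedVafaWittenWilsonDiracAccretive

/-- **`RenormalisedVafaWitten.WilsonDiracAccretive` holds** (stmt-QuantumFields-8697), route-level name.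
[cite: MontvayMunster1994, §4.2.2 (4.85) with §5.1.1 (5.5)] -/
theorem Summit.QuantumFields.QCD.Theorems.renormalisedVafaWitten_wilsonDiracAccretive_proof :
    Summit.QuantumFields.QCD.Theses.RenormalisedVafaWitten.WilsonDiracAccretive :=
  Summit.QuantumFields.QCD.Theorems.RenormalisedVafaWittenWilsonDiracAccretive.wilsonDiracAccretive_proof
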